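import Summits.ResolutionOfSingularities.ResolutionOfSingularities.Theorems.RadicialJungCleanModelsStubLooseCleanOfGiraudNormalFormAt
import Summits.ResolutionOfSingularities.ResolutionOfSingularities.Theorems.RadicialJungCleanModelsStubExtendParameter
import Summits.ResolutionOfSingularities.ResolutionOfSingularities.Theorems.RadicialJungCleanModelsStubParameterSubset
import Mathlib.RingTheory.Kaehler.Basic
import HarnessLib

/-!
# Stub `stub_looseCleanOfGiraud15` for crux stmt-ResolutionOfSingularities-15917
(`RadicialJung.CleanModels`, line `Sketch`)

**Giraud's normal form (Prop. 1.5 (ii)) implies loose cleanness.** Let `O` be a regular local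
domain of prime characteristic `p` with fraction field `K` and residue field `κ`, `t : Fin d → O`
a minimal generating system of `𝔪` (`d = dim O`), `x_j := t_j` (`j < r`), and
`f = g^p + u ∏_{j<r} x_j^{a_j}` where either (c-1) some `p ∤ a_j` and `u` is a unit, or (c-2) the
elements `1 ⊗ dx_j` (`j < r`), `1 ⊗ du` of `κ ⊗_O Ω_{O/ℤ}` are `κ`-linearly independent. Then some
representative `c₀^p + c₁^p f` (`c₁ ≠ 0`) of the `K^p`-line of `f` is loosely clean: toroidal
`w ∏_{i<m} t'_i^{a'_i}` (`w` a unit, `t'` a minimal generating system of `𝔪`, all `p ∤ a'_i`,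
`m ≥ 1`), or a unit residually not a `p`-th power, or `c^p +` (an element of `𝔪 ∖ 𝔪²`).

Proof. With `y := ∏ x_j^{⌊a_j/p⌋} ≠ 0`, `c₁ := y⁻¹`, `c₀ := -g y⁻¹` one gets
`c₀^p + c₁^p f = u ∏_{j ∈ S} x_j^{a_j mod p}`, `S := {j : p ∤ a_j}` (template
`stub_looseCleanOfGiraudNormalFormAt`). The `κ`-linear map `δ : z ↦ 1 ⊗ dz` kills `𝔪²`
(`d(bc) = b dc + c db` and `b̄ = 0` for `b ∈ 𝔪`) and `δ(c^p) = 0` in characteristic `p`.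
* `S ≠ ∅`, `u` a unit: re-enumerate `t` with the `x_j`, `j ∈ S`, first — toroidal.
* `S ≠ ∅`, `u ∈ 𝔪` (so (c-2) holds): `δ u ∉ ⟨δ x_j⟩_κ` gives `u ∉ 𝔪² + (x_j)_{j ∈ S}`, so the image
  of `u` in the regular local ring `O/(x_j)_{j∈S}` (Matsumura 14.2) lies in `𝔪 ∖ 𝔪²` and extends
  to a regular system of parameters there (`stub_extendParameter`); lifting and prepending the
  `x_j` gives a minimal generating system `(u, x_j (j ∈ S), …)` of `𝔪` — toroidal with `w = 1`.
* `S = ∅` (so (c-2) holds, `δ u ≠ 0`): `c₀^p + c₁^p f = u`; either `u - c^p ∉ 𝔪` for all `c`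
  (then `u` is a unit), or `u - c^p ∈ 𝔪` for some `c`, and then `u - c^p ∉ 𝔪²` since
  `δ(u - c^p) = δ u ≠ 0`.
-/

noncomputable section

set_option linter.dupNamespace false

open IsLocalRing RingTheory.Sequence
open Literature.AlgebraicGeometry.Resolution
open scoped TensorProduct

namespace Summit.ResolutionOfSingularities.ResolutionOfSingularities.Theorems.RadicialJung.CleanModels

universe u

section Derivation

variable {O : Type u} [CommRing O] [IsLocalRing O]

/-- Leibniz rule for `z ↦ 1 ⊗ dz : O → κ ⊗_O Ω_{O/ℤ}`:
`1 ⊗ d(bc) = b̄ • (1 ⊗ dc) + c̄ • (1 ⊗ db)`. -/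
theorem one_tmul_D_mul (b c : O) :
    ((1 : ResidueField O) ⊗ₜ[O] KaehlerDifferential.D ℤ O (b * c) :
        ResidueField O ⊗[O] (Ω[O⁄ℤ])) =
      residue O b • ((1 : ResidueField O) ⊗ₜ[O] KaehlerDifferential.D ℤ O c) +
        residue O c • ((1 : ResidueField O) ⊗ₜ[O] KaehlerDifferential.D ℤ O b) := by
  rw [Derivation.leibniz, TensorProduct.tmul_add, TensorProduct.tmul_smul, TensorProduct.tmul_smul,
    ← IsScalarTower.algebraMap_smul (ResidueField O) b,
    ← IsScalarTower.algebraMap_smul (ResidueField O) c]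
  rfl

/-- `1 ⊗ d(bc) = 0` in `κ ⊗_O Ω_{O/ℤ}` for `b, c ∈ 𝔪`. -/
theorem one_tmul_D_mul_eq_zero {b c : O} (hb : b ∈ maximalIdeal O) (hc : c ∈ maximalIdeal O) :
    ((1 : ResidueField O) ⊗ₜ[O] KaehlerDifferential.D ℤ O (b * c) :
        ResidueField O ⊗[O] (Ω[O⁄ℤ])) = 0 := by
  rw [one_tmul_D_mul, (residue_eq_zero_iff b).mpr hb, (residue_eq_zero_iff c).mpr hc, zero_smul,
    zero_smul, add_zero]

/-- The map `z ↦ 1 ⊗ dz : O → κ ⊗_O Ω_{O/ℤ}` kills `𝔪²`. -/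
theorem one_tmul_D_eq_zero_of_mem_sq {z : O} (hz : z ∈ maximalIdeal O ^ 2) :
    ((1 : ResidueField O) ⊗ₜ[O] KaehlerDifferential.D ℤ O z :
        ResidueField O ⊗[O] (Ω[O⁄ℤ])) = 0 := by
  rw [pow_two] at hz
  refine Submodule.mul_induction_on hz (fun b hb c hc => one_tmul_D_mul_eq_zero hb hc) ?_
  intro x y hx hy
  rw [map_add, TensorProduct.tmul_add, hx, hy, add_zero]

/-- For `z ∈ 𝔪² + (y_i)_i` with all `y_i ∈ 𝔪`, `1 ⊗ dz` lies in the `κ`-span of the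
`1 ⊗ dy_i`. -/
theorem one_tmul_D_mem_span {ι : Type*} (y : ι → O) (hy : ∀ i, y i ∈ maximalIdeal O) {z : O}
    (hz : z ∈ maximalIdeal O ^ 2 ⊔ Ideal.span (Set.range y)) :
    ((1 : ResidueField O) ⊗ₜ[O] KaehlerDifferential.D ℤ O z :
        ResidueField O ⊗[O] (Ω[O⁄ℤ])) ∈
      Submodule.span (ResidueField O)
        (Set.range fun i => ((1 : ResidueField O) ⊗ₜ[O] KaehlerDifferential.D ℤ O (y i) :
          ResidueField O ⊗[O] (Ω[O⁄ℤ]))) := by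
  obtain ⟨z₁, hz₁, z₂, hz₂, rfl⟩ := Submodule.mem_sup.mp hz
  rw [map_add, TensorProduct.tmul_add, one_tmul_D_eq_zero_of_mem_sq hz₁, zero_add]
  refine Submodule.span_induction (p := fun w _ => ((1 : ResidueField O) ⊗ₜ[O]
      KaehlerDifferential.D ℤ O w : ResidueField O ⊗[O] (Ω[O⁄ℤ])) ∈
        Submodule.span (ResidueField O)
          (Set.range fun i => ((1 : ResidueField O) ⊗ₜ[O] KaehlerDifferential.D ℤ O (y i) :
            ResidueField O ⊗[O] (Ω[O⁄ℤ])))) ?_ ?_ ?_ ?_ hz₂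
  · rintro _ ⟨i, rfl⟩
    exact Submodule.subset_span ⟨i, rfl⟩
  · rw [map_zero, TensorProduct.tmul_zero]
    exact zero_mem _
  · intro v w _ _ hv hw
    rw [map_add, TensorProduct.tmul_add]
    exact add_mem hv hw
  · intro r w hw hw'
    have hwm : w ∈ maximalIdeal O := by
      refine (Ideal.span_le.mpr ?_) hw
      rintro _ ⟨i, rfl⟩
      exact hy i
    rw [smul_eq_mul, one_tmul_D_mul, (residue_eq_zero_iff w).mpr hwm, zero_smul, add_zero]
    exact Submodule.smul_mem _ _ hw'

/-- In characteristic `p`: `1 ⊗ d(c^p) = 0` (`d(c^p) = p c^{p-1} dc`). -/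
theorem one_tmul_D_pow_char (p : ℕ) [CharP O p] (c : O) :
    ((1 : ResidueField O) ⊗ₜ[O] KaehlerDifferential.D ℤ O (c ^ p) :
        ResidueField O ⊗[O] (Ω[O⁄ℤ])) = 0 := by
  rw [Derivation.leibniz_pow, ← Nat.cast_smul_eq_nsmul O, CharP.cast_eq_zero, zero_smul,
    TensorProduct.tmul_zero]

end Derivation

/-- The range of an appended family is the union of the ranges (a private copy of the tree's
`range_fin_append_eq` of `CleanSpreadsToroidal.lean`, kept local to avoid a heavy import). -/
private theorem range_fin_append_eq_union {α : Type*} {m n : ℕ} (u : Fin m → α) (v : Fin n → α) :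
    Set.range (Fin.append u v) = Set.range u ∪ Set.range v := by
  ext x
  constructor
  · rintro ⟨i, rfl⟩
    refine Fin.addCases (fun j => ?_) (fun j => ?_) i
    · exact Or.inl ⟨j, (Fin.append_left u v j).symm⟩
    · exact Or.inr ⟨j, (Fin.append_right u v j).symm⟩
  · rintro (⟨j, rfl⟩ | ⟨j, rfl⟩)
    · exact ⟨Fin.castAdd n j, Fin.append_left u v j⟩
    · exact ⟨Fin.natAdd m j, Fin.append_right u v j⟩

/-- **Part of a regular system of parameters plus one more element extend to a regular system of
parameters.** Let `t : Fin d → O` generate the maximal ideal of a regular local ring `O` of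
dimension `d`, `ι : Fin m ↪ Fin d`, and `u ∈ 𝔪` with `u ∉ 𝔪² + (t (ι j))_j`. Then there is a
generating family `t' : Fin d' → O` of `𝔪`, `d' = dim O`, starting with
`u, t (ι 0), …, t (ι (m-1))`: `O/(t ∘ ι)` is regular (Matsumura Thm. 14.2) of dimension `d - m`
(`t ∘ ι` is a regular sequence) and the image of `u` lies in `𝔪 ∖ 𝔪²` there, so it extends to a
regular system of parameters of the quotient (`stub_extendParameter`); lift it and prepend. -/
theorem exists_rsop_cons {O : Type*} [CommRing O] [IsRegularLocalRing O] {d : ℕ}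
    (t : Fin d → O) (ht : Ideal.span (Set.range t) = maximalIdeal O)
    (hd : ringKrullDim O = (d : WithBot ℕ∞)) {m : ℕ} (ι : Fin m → Fin d)
    (hι : Function.Injective ι) {u : O} (hu : u ∈ maximalIdeal O)
    (hu2 : u ∉ maximalIdeal O ^ 2 ⊔ Ideal.span (Set.range fun j => t (ι j))) :
    ∃ (d' : ℕ) (hmd : m + 1 ≤ d') (t' : Fin d' → O),
      Ideal.span (Set.range t') = maximalIdeal O ∧ ringKrullDim O = (d' : WithBot ℕ∞) ∧
      ∀ j : Fin (m + 1),
        t' (Fin.castLE hmd j) = (Fin.cons u (fun j => t (ι j)) : Fin (m + 1) → O) j := by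
  classical
  -- the ideal `J = (t (ι j))_j ⊆ 𝔪`
  obtain ⟨J, hJ⟩ : ∃ J : Ideal O, J = Ideal.span (Set.range fun j => t (ι j)) := ⟨_, rfl⟩
  have htm : ∀ i, t i ∈ maximalIdeal O := fun i => ht ▸ Ideal.subset_span ⟨i, rfl⟩
  have hd' : (maximalIdeal O).spanFinrank = d := by
    have h := IsRegularLocalRing.spanFinrank_maximalIdeal (R := O)
    rw [hd] at h
    exact_mod_cast h
  -- (1) `O ⧸ J` is a regular local ring (Matsumura Thm. 14.2)
  haveI hOJ : IsRegularLocalRing (O ⧸ J) := by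
    have h := isRegularLocalRing_quotient_span_image hd' t ht (Finset.univ.image ι)
    have him : t '' ((Finset.univ.image ι : Finset (Fin d)) : Set (Fin d)) =
        Set.range fun j => t (ι j) := by
      rw [Finset.coe_image, Finset.coe_univ, Set.image_univ, ← Set.range_comp]
      rfl
    rwa [him, ← hJ] at h
  -- (2) the image `ū` of `u` lies in `𝔪_{O/J} ∖ 𝔪_{O/J}²`
  have hmapm : (maximalIdeal O).map (Ideal.Quotient.mk J) = maximalIdeal (O ⧸ J) :=
    map_maximalIdeal_of_surjective _ Ideal.Quotient.mk_surjective
  have hū : Ideal.Quotient.mk J u ∈ maximalIdeal (O ⧸ J) :=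
    hmapm ▸ Ideal.mem_map_of_mem _ hu
  have hū2 : Ideal.Quotient.mk J u ∉ maximalIdeal (O ⧸ J) ^ 2 := by
    rw [← hmapm, ← Ideal.map_pow, ← Ideal.mem_comap,
      Ideal.comap_map_of_surjective' _ Ideal.Quotient.mk_surjective, Ideal.mk_ker, hJ]
    exact hu2
  -- (3) extend `ū` to a regular system of parameters `t''` of `O ⧸ J`
  obtain ⟨e, he0, t'', ht'', hdime, ht''0⟩ := stub_extendParameter _ hū hū2
  obtain ⟨e', rfl⟩ : ∃ e', e = e' + 1 := ⟨e - 1, (Nat.sub_add_cancel he0).symm⟩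
  -- (4) `dim O/J + m = dim O` (`t ∘ ι` is an `O`-regular sequence)
  have hdim : ringKrullDim (O ⧸ J) + m = ringKrullDim O := by
    have hw : IsWeaklyRegular O (List.ofFn fun j => t (ι j)) :=
      isWeaklyRegular_ofFn_of_span_eq_maximalIdeal t ht hd ι hι
    have hr : IsRegular O (List.ofFn fun j => t (ι j)) :=
      (IsLocalRing.isRegular_iff_isWeaklyRegular_of_subset_maximalIdeal fun r hr => by
        obtain ⟨j, rfl⟩ := (List.mem_ofFn' _ r).mp hr
        exact htm (ι j)).mpr hw
    have h := ringKrullDim_add_length_eq_ringKrullDim_of_isRegular _ hr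
    rw [List.length_ofFn] at h
    have hofList : Ideal.ofList (List.ofFn fun j => t (ι j)) = J := by
      rw [hJ]
      exact congrArg Ideal.span (Set.ext fun a => List.mem_ofFn' _ a)
    rwa [hofList] at h
  -- (5) lift the tail of `t''` to `O`; with `u` in front this lifts `t''`
  choose v hv using fun k : Fin e' => Ideal.Quotient.mk_surjective (t'' k.succ)
  have huv : (Ideal.Quotient.mk J) ∘ (Fin.cons u v : Fin (e' + 1) → O) = t'' := by
    funext k
    refine Fin.cases ?_ (fun k => ?_) k
    · rw [Function.comp_apply, Fin.cons_zero, ← ht''0]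
      rfl
    · rw [Function.comp_apply, Fin.cons_succ, hv]
  refine ⟨m + 1 + e', Nat.le_add_right _ _,
    Fin.append (Fin.cons u fun j => t (ι j) : Fin (m + 1) → O) v, ?_, ?_,
    fun j => Fin.append_left' _ _ j⟩
  · -- `(u, t ∘ ι, v) = 𝔪`: the preimage of `𝔪_{O/J} = (ū, v̄)` is `(u, v) + J`
    have h2 : (Ideal.span (Set.range (Fin.cons u v : Fin (e' + 1) → O))).map
        (Ideal.Quotient.mk J) = maximalIdeal (O ⧸ J) := by
      rw [Ideal.map_span, ← Set.range_comp, huv, ht'']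
    haveI : IsLocalHom (Ideal.Quotient.mk J) :=
      IsLocalHom.of_surjective _ Ideal.Quotient.mk_surjective
    have h3 : maximalIdeal O =
        Ideal.span (Set.range (Fin.cons u v : Fin (e' + 1) → O)) ⊔ J := by
      rw [← IsLocalRing.maximalIdeal_comap (Ideal.Quotient.mk J), ← h2,
        Ideal.comap_map_of_surjective' _ Ideal.Quotient.mk_surjective, Ideal.mk_ker]
    rw [h3, range_fin_append_eq_union, Fin.range_cons, Fin.range_cons, hJ]
    simp only [Ideal.span_union, Ideal.span_insert]
    ac_rfl
  · -- `dim O = dim O/J + m = (e' + 1) + m`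
    rw [← hdim, hdime, ← Nat.cast_add (R := WithBot ℕ∞)]
    congr 1
    omega

/-- **Giraud's normal form (Prop. 1.5 (ii)) implies loose cleanness.** In a regular local domain
`O` of prime characteristic `p` with fraction field `K`, let `x_j := t_j` (`j < r`) be the first
members of a minimal generating system `t : Fin d → O` of `𝔪` (`d = dim O`) and
`f = g^p + u ∏_{j<r} x_j^{a_j}` with either (c-1) some `p ∤ a_j` and `u` a unit, or (c-2)
`1 ⊗ dx_j` (`j < r`), `1 ⊗ du` linearly independent in `κ ⊗_O Ω_{O/ℤ}`. Then some representative
`c₀^p + c₁^p f` (`c₁ ≠ 0`) of the `K^p`-line of `f` is loosely clean: toroidal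
`w ∏_{i<m} t'_i^{a'_i}` for a minimal generating system `t'` of `𝔪`, a unit `w`, `m ≥ 1` and all
`p ∤ a'_i`; or a unit residually not a `p`-th power; or `c^p +` (an element of `𝔪 ∖ 𝔪²`). -/
theorem stub_looseCleanOfGiraud15 {O K : Type u} [CommRing O] [IsRegularLocalRing O]
    [IsDomain O] [Field K] [Algebra O K] [IsFractionRing O K] (p : ℕ) (hp : p.Prime) [CharP O p]
    {d r : ℕ} (hrd : r ≤ d) (t : Fin d → O) (ht : Ideal.span (Set.range t) = maximalIdeal O)
    (hd : ringKrullDim O = (d : WithBot ℕ∞)) (g u : O) (a : Fin r → ℕ) (f : O)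
    (hf : f = g ^ p + u * ∏ i : Fin r, t (Fin.castLE hrd i) ^ a i)
    (hc : ((∃ i, ¬ p ∣ a i) ∧ IsUnit u) ∨
      LinearIndependent (ResidueField O)
        (fun i : Fin (r + 1) =>
          ((1 : ResidueField O) ⊗ₜ[O]
            KaehlerDifferential.D ℤ O
              ((Fin.snoc (fun i : Fin r => t (Fin.castLE hrd i)) u : Fin (r + 1) → O) i) :
            ResidueField O ⊗[O] (Ω[O⁄ℤ])))) :
    ∃ c₀ c₁ : K, c₁ ≠ 0 ∧
      ((∃ (d' m : ℕ) (hmd : m ≤ d') (t' : Fin d' → O) (a' : Fin m → ℕ) (w : O), IsUnit w ∧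
          Ideal.span (Set.range t') = maximalIdeal O ∧
          ringKrullDim O = (d' : WithBot ℕ∞) ∧ 0 < m ∧ (∀ i, ¬ p ∣ a' i) ∧
          c₀ ^ p + c₁ ^ p * algebraMap O K f =
            algebraMap O K (w * ∏ i : Fin m, t' (Fin.castLE hmd i) ^ (a' i))) ∨
        (∃ w : O, IsUnit w ∧ c₀ ^ p + c₁ ^ p * algebraMap O K f = algebraMap O K w ∧
          ∀ c : O, w - c ^ p ∉ maximalIdeal O) ∨
        (∃ s c : O, c₀ ^ p + c₁ ^ p * algebraMap O K f = algebraMap O K s ∧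
          s - c ^ p ∈ maximalIdeal O ∧ s - c ^ p ∉ maximalIdeal O ^ 2)) := by
  classical
  haveI : Fact p.Prime := ⟨hp⟩
  haveI : CharP K p := charP_of_injective_algebraMap (IsFractionRing.injective O K) p
  set x : Fin r → O := fun j => t (Fin.castLE hrd j) with hx
  have hxm : ∀ j, x j ∈ maximalIdeal O := fun j => ht ▸ Ideal.subset_span ⟨_, rfl⟩
  have hxne : ∀ j, algebraMap O K (x j) ≠ 0 := fun j =>
    (map_ne_zero_iff _ (IsFractionRing.injective O K)).mpr (rsop_apply_ne_zero t ht hd _)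
  have hprodne : ∀ n : Fin r → ℕ, algebraMap O K (∏ j, x j ^ n j) ≠ 0 := fun n => by
    rw [map_prod]
    exact Finset.prod_ne_zero_iff.mpr fun j _ => by rw [map_pow]; exact pow_ne_zero _ (hxne j)
  -- divide by `y^p`, `y = ∏ x_j^{⌊a_j/p⌋}`: `c₀^p + c₁^p f = u ∏ x_j^{a_j mod p}`
  have hyK := hprodne fun j => a j / p
  set y : O := ∏ j, x j ^ (a j / p) with hy
  have hprod : ∏ j, x j ^ a j = y ^ p * ∏ j, x j ^ (a j % p) := by
    rw [hy, ← Finset.prod_pow, ← Finset.prod_mul_distrib]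
    refine Finset.prod_congr rfl fun j _ => ?_
    rw [← pow_mul, ← pow_add, Nat.div_add_mod']
  refine ⟨-(algebraMap O K g) * (algebraMap O K y)⁻¹, (algebraMap O K y)⁻¹, inv_ne_zero hyK, ?_⟩
  have heq : (-(algebraMap O K g) * (algebraMap O K y)⁻¹) ^ p +
      ((algebraMap O K y)⁻¹) ^ p * algebraMap O K f =
        algebraMap O K (u * ∏ j, x j ^ (a j % p)) := by
    have hf' : algebraMap O K f = algebraMap O K g ^ p +
        algebraMap O K y ^ p * algebraMap O K (u * ∏ j, x j ^ (a j % p)) := by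
      rw [hf, hprod]; simp only [map_add, map_mul, map_pow]; ring
    rw [hf']
    exact neg_mul_pow_add_pow_mul_eq p _ _ _ _ (inv_mul_cancel₀ hyK)
  -- the indices `S` with exponent prime to `p`, enumerated by `emb`
  set S : Finset (Fin r) := Finset.univ.filter fun j => a j % p ≠ 0 with hS
  have hoff : ∀ j, j ∉ S → a j % p = 0 := fun j hj => by
    by_contra h
    exact hj (Finset.mem_filter.mpr ⟨Finset.mem_univ _, h⟩)
  have hmemS : ∀ j, j ∈ S → ¬ p ∣ a j % p := fun j hj =>
    Nat.not_dvd_of_pos_of_lt (Nat.pos_of_ne_zero (Finset.mem_filter.mp hj).2)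
      (Nat.mod_lt _ hp.pos)
  obtain ⟨emb, hembS, hembinj, hembprod⟩ := exists_enumeration S x
  -- the differential condition, as a `Fin.snoc` family
  have hcomp : (fun i : Fin (r + 1) => ((1 : ResidueField O) ⊗ₜ[O] KaehlerDifferential.D ℤ O
      ((Fin.snoc x u : Fin (r + 1) → O) i) : ResidueField O ⊗[O] (Ω[O⁄ℤ]))) =
      Fin.snoc (fun j => ((1 : ResidueField O) ⊗ₜ[O] KaehlerDifferential.D ℤ O (x j) :
          ResidueField O ⊗[O] (Ω[O⁄ℤ])))
        ((1 : ResidueField O) ⊗ₜ[O] KaehlerDifferential.D ℤ O u) :=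
    Fin.comp_snoc (fun z : O => ((1 : ResidueField O) ⊗ₜ[O] KaehlerDifferential.D ℤ O z :
      ResidueField O ⊗[O] (Ω[O⁄ℤ]))) x u
  rcases S.eq_empty_or_nonempty with hS0 | ⟨j₀, hj₀S⟩
  · -- all exponents divisible by `p`: `c₀^p + c₁^p f = u` and (c-2) holds, so `1 ⊗ du ≠ 0`
    have hnot : ∀ j, j ∉ S := fun j => by rw [hS0]; exact Finset.notMem_empty j
    have hprod1 : ∏ j, x j ^ (a j % p) = 1 :=
      Finset.prod_eq_one fun j _ => by rw [hoff j (hnot j), pow_zero]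
    rw [hprod1, mul_one] at heq
    have hli := hc.resolve_left fun h => by
      obtain ⟨⟨i, hi⟩, -⟩ := h
      exact hi (Nat.dvd_of_mod_eq_zero (hoff i (hnot i)))
    rw [hcomp] at hli
    have hdu : ((1 : ResidueField O) ⊗ₜ[O] KaehlerDifferential.D ℤ O u :
        ResidueField O ⊗[O] (Ω[O⁄ℤ])) ≠ 0 := by
      have h := hli.ne_zero (Fin.last r)
      rwa [Fin.snoc_last] at h
    by_cases hw : ∀ c : O, u - c ^ p ∉ maximalIdeal O
    · refine Or.inr (Or.inl ⟨u, ?_, heq, hw⟩)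
      by_contra hnu
      refine hw 0 ?_
      rw [zero_pow hp.ne_zero, sub_zero]
      exact (IsLocalRing.mem_maximalIdeal _).mpr (mem_nonunits_iff.mpr hnu)
    · push Not at hw
      obtain ⟨c, hcm⟩ := hw
      refine Or.inr (Or.inr ⟨u, c, heq, hcm, fun h2 => hdu ?_⟩)
      have h := one_tmul_D_eq_zero_of_mem_sq h2
      rwa [map_sub, TensorProduct.tmul_sub, one_tmul_D_pow_char p c, sub_zero] at h
  · by_cases hunit : IsUnit u
    · -- toroidal with the unit `u`: re-enumerate `t` with the `x_j`, `j ∈ S`, first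
      have hmd : S.card ≤ d :=
        ((Finset.card_le_univ S).trans (Fintype.card_fin r).le).trans hrd
      obtain ⟨σ, hσ⟩ := Equiv.Perm.exists_extending_pair (Fin.castLE hmd)
        (fun i => Fin.castLE hrd (emb i)) (Fin.castLE_injective hmd)
        ((Fin.castLE_injective hrd).comp hembinj)
      have hre : ∏ i : Fin S.card, (t ∘ σ) (Fin.castLE hmd i) ^ (a (emb i) % p) =
          ∏ j, x j ^ (a j % p) := by
        rw [← hembprod (fun j => a j % p) hoff]
        exact Finset.prod_congr rfl fun i _ => by rw [Function.comp_apply, hσ]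
      refine Or.inl ⟨d, S.card, hmd, t ∘ σ, fun i => a (emb i) % p, u, hunit, ?_, hd,
        Finset.card_pos.mpr ⟨j₀, hj₀S⟩, fun i => hmemS _ (hembS i), by rw [heq, hre]⟩
      rw [Set.range_comp, σ.surjective.range_eq, Set.image_univ, ht]
    · -- `u ∈ 𝔪` and (c-2) holds: `(u, x_j (j ∈ S))` extends to a minimal generating system
      have hum : u ∈ maximalIdeal O :=
        (IsLocalRing.mem_maximalIdeal _).mpr (mem_nonunits_iff.mpr hunit)
      have hli := hc.resolve_left fun h => hunit h.2
      rw [hcomp, linearIndependent_finSnoc] at hli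
      have hu2 : u ∉ maximalIdeal O ^ 2 ⊔ Ideal.span (Set.range fun i => x (emb i)) := by
        intro h
        refine hli.2 (Submodule.span_mono ?_ (one_tmul_D_mem_span (fun i => x (emb i))
          (fun i => hxm _) h))
        rintro _ ⟨i, rfl⟩
        exact ⟨emb i, rfl⟩
      obtain ⟨d', hmd, t', ht', hd', ht'c⟩ := exists_rsop_cons t ht hd
        (fun i => Fin.castLE hrd (emb i)) ((Fin.castLE_injective hrd).comp hembinj) hum hu2
      have hre : ∏ i : Fin (S.card + 1), t' (Fin.castLE hmd i) ^
          (Fin.cons 1 (fun i => a (emb i) % p) : Fin (S.card + 1) → ℕ) i =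
            u * ∏ j, x j ^ (a j % p) := by
        rw [Fin.prod_univ_succ, ht'c 0, Fin.cons_zero, Fin.cons_zero, pow_one,
          ← hembprod (fun j => a j % p) hoff]
        congr 1
        exact Finset.prod_congr rfl fun i _ => by rw [ht'c i.succ, Fin.cons_succ, Fin.cons_succ]
      refine Or.inl ⟨d', S.card + 1, hmd, t', Fin.cons 1 fun i => a (emb i) % p, 1, isUnit_one,
        ht', hd', Nat.succ_pos _, fun i => ?_, by rw [heq, one_mul, hre]⟩
      refine Fin.cases ?_ (fun i => ?_) i
      · rw [Fin.cons_zero]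
        exact fun h => hp.ne_one (Nat.dvd_one.mp h)
      · rw [Fin.cons_succ]
        exact hmemS _ (hembS i)

end Summit.ResolutionOfSingularities.ResolutionOfSingularities.Theorems.RadicialJung.CleanModels

end
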